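import Literature.Barriers.ResolutionOfSingularities.InseparableBaseChangeResolution
import Literature.AlgebraicGeometry.Resolution.ResolutionGlue
import Literature.AlgebraicGeometry.Motives.GoodReductionSpecialFibreProofs
import Mathlib.AlgebraicGeometry.Morphisms.Proper
import HarnessLib

/-!
# `DescentPerfectToAll` — negative lemma: no one-root robustness at a fixed level

Support (negative) lemma for crux `stmt-ResolutionOfSingularities-0549`
(`Summit.ResolutionOfSingularities.ResolutionOfSingularities.Theses.Descent.DescentPerfectToAll` and
its rfl-equal route copies). It lands the typed negative target of the crux directory
`Cruxes/DescentPerfectToAll/NegativeTarget_cstrat_p1.lean` (crux-strategist p1, 2026-08-17;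
STRATEGY-CENSUS.md §2.4 / §4.2 (N-a)): the UP-direction analogue of the dead core F″,

  `OneRootRobustAtFixedLevel p` := "over `k` of characteristic `p`, `K = k(a^{1/p})` with
  `a ∉ k^p`: every normal integral separated finite-type `X/k` that has a resolution has a
  resolution `Y → X` whose base change `Y ×ₖ K` is still regular",

is FALSE for every prime `p` (`not_oneRootRobustAtFixedLevel`, the `def` unfolded verbatim).

WITNESS (zero-dimensional, degenerate on purpose). `k = 𝔽_p(t)`, `a = t`, `K = k(t^{1/p})`
(`baseField p`, `extField p` of `Literature.Barriers.ResolutionOfSingularities.InseparableBaseChange`),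
and `X = Spec K` viewed as a `k`-scheme: integral, separated, of finite type, with integrally
closed stalks, regular (so `X` is its own resolution). `X` is ALREADY WOUNDED for the root
`t^{1/p}`: a proper birational `π : Y → X` onto the one-point scheme `X` is an isomorphism over a
dense open, i.e. over all of `X`, hence an isomorphism (`isIso_of_isBirational_of_subsingleton`),
so `Y ×ₖ K ≅ X ×ₖ K = Spec (K ⊗ₖ K)`, the non-reduced inseparable point, is not regular
(`not_isRegular_pullback_extField`, landed with the barrier `InseparableBaseChangeResolution`).

WHAT THIS DOES AND DOES NOT SAY. The typed target quantified over ALL normal `X`, wounded ones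
included, and is therefore killed by any regular `X` carrying a wound (the wound is inherited by
every model dominating `X` — here trivially, every resolution of a point being the point). The
SUBSTANTIVE phenomenon of STRATEGY-CENSUS §2.4 — an UNWOUNDED normal surface
`X = {yz = (x^p − μ)²}` (uniformly cotangent-stable, `X ×ₖ K` normal) none of whose resolutions is
robust, because the wound is CREATED on the minimal resolution `Bl_P X` and every resolution of
the excellent surface `X` dominates it — is not formalised here (it needs domination of the
minimal resolution); the honest sharpened target adds the hypothesis "`X ×ₖ K` is normal" (or
"`X ×ₖ K` is regular over `Reg X`") to `OneRootRobustAtFixedLevel`, and this file says nothing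
about it. Nothing here bears on the crux or the summit as stated; it constrains a MECHANISM
(raise the level once, then resolve robustly) exactly as the census records.

## Sources
* Q. Liu, Algebraic Geometry and Arithmetic Curves, OUP 2002, Example 3.2.12, Remark 4.3.34.
* Cruxes/DescentPerfectToAll/STRATEGY-CENSUS.md §2.3 (a), §2.4, §4.2 (this tree, 2026-08-17).
-/

noncomputable section

open CategoryTheory CategoryTheory.Limits AlgebraicGeometry TopologicalSpace
open Literature.AlgebraicGeometry.Resolution
open Literature.Barriers.ResolutionOfSingularities

set_option linter.dupNamespace false -- mandated namespace `…ResolutionOfSingularities.ResolutionOfSingularities…` of this single-conjunct summit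

namespace Summit.ResolutionOfSingularities.ResolutionOfSingularities.Theorems.DescentPerfectToAll.Negative

universe u

/-- **A birational morphism onto a one-point scheme is an isomorphism**: the dense open over
which it restricts to an isomorphism is everything, and its (dense, hence here total) preimage is
the whole source. [folklore] -/
theorem isIso_of_isBirational_of_subsingleton {Y P : Scheme.{u}} (π : Y ⟶ P)
    [Subsingleton ↥P] [Nonempty ↥P] (hbir : IsBirational π) : IsIso π := by
  obtain ⟨U, hU, -, hUiso⟩ := hbir
  obtain ⟨x, hx⟩ := hU.nonempty
  have hUtop : U = ⊤ := by
    ext y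
    simp only [Opens.coe_top, Set.mem_univ, iff_true]
    rw [Subsingleton.elim y x]
    exact hx
  subst hUtop
  haveI := hUiso
  -- `j : π⁻¹(⊤) → P` is an open immersion hitting the unique point, hence an isomorphism
  let j : (↑(π ⁻¹ᵁ (⊤ : P.Opens)) : Scheme.{u}) ⟶ P := (π ⁻¹ᵁ (⊤ : P.Opens)).ι ≫ π
  have hj : j = (π ∣_ (⊤ : P.Opens)) ≫ (⊤ : P.Opens).ι := (morphismRestrict_ι π ⊤).symm
  haveI : IsOpenImmersion j := by rw [hj]; infer_instance
  haveI : Epi j.base := by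
    rw [TopCat.epi_iff_surjective]
    intro y
    have x₁ : ↥(↑(π ⁻¹ᵁ (⊤ : P.Opens)) : Scheme.{u}) :=
      (inv (π ∣_ (⊤ : P.Opens))).base ⟨y, trivial⟩
    exact ⟨x₁, Subsingleton.elim _ _⟩
  haveI hjiso : IsIso j := IsOpenImmersion.isIso j
  -- the inclusion `π⁻¹(⊤) ↪ Y` is a surjective open immersion, hence an isomorphism as well
  let ι : (↑(π ⁻¹ᵁ (⊤ : P.Opens)) : Scheme.{u}) ⟶ Y := (π ⁻¹ᵁ (⊤ : P.Opens)).ι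
  haveI : Epi ι.base := by
    rw [TopCat.epi_iff_surjective]
    intro y
    exact ⟨⟨y, by simp⟩, rfl⟩
  haveI hιiso : IsIso ι := IsOpenImmersion.isIso ι
  -- so `π = ι⁻¹ ≫ j` is one
  have hπ : π = inv ι ≫ j := by
    simp only [j, ι, IsIso.inv_hom_id_assoc]
  rw [hπ]
  infer_instance

/-- `k(t^{1/p})` is generated over `k = 𝔽_p(t)` by the root `t^{1/p}` as an intermediate field.
[folklore] -/
theorem adjoin_root_extField_eq_top (p : ℕ) [Fact p.Prime] :
    IntermediateField.adjoin (baseField p) {AdjoinRoot.root (insepPoly p)} =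
      (⊤ : IntermediateField (baseField p) (extField p)) := by
  rw [eq_top_iff]
  intro x _
  have hx : x ∈ Algebra.adjoin (baseField p) {AdjoinRoot.root (insepPoly p)} := by
    rw [AdjoinRoot.adjoinRoot_eq_top]; trivial
  exact IntermediateField.algebra_adjoin_le_adjoin _ _ hx

/-- **`OneRootRobustAtFixedLevel p` is false for every prime `p`** (the `def` of
`Cruxes/DescentPerfectToAll/NegativeTarget_cstrat_p1.lean`, unfolded verbatim and negated): it is
NOT the case that for all fields `k ⊆ K` of characteristic `p` with `K = k(α)`, `α^p = a ∉ k^p`,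
every integral separated finite-type `X → Spec k` with integrally closed stalks and a resolution
admits a resolution `Y → X` (proper, birational, `Y` regular) whose base change
`Y ×_{Spec k} Spec K` is regular. Witness: `k = 𝔽_p(t)`, `a = t`, `X = Spec k(t^{1/p})` — every
resolution of the point `X` is an isomorphism, and `X ×ₖ K = Spec (K ⊗ₖ K)` is not reduced.
STRATEGY-CENSUS §2.4's unwounded surface example (no robust resolution although `X ×ₖ K` is
normal) is the substantive, still unformalised, version. [cite: Liu2002, Example 3.2.12 and
Remark 4.3.34] -/
theorem not_oneRootRobustAtFixedLevel (p : ℕ) [Fact p.Prime] :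
    ¬ ∀ (k K : Type) [Field k] [Field K] [Algebra k K] [CharP k p] (a : k) (α : K),
      (∀ b : k, b ^ p ≠ a) → α ^ p = algebraMap k K a → IntermediateField.adjoin k {α} = ⊤ →
      ∀ (X : Scheme.{0}) (f : X ⟶ Spec (.of k)), IsSeparated f → LocallyOfFiniteType f →
        QuasiCompact f → IsIntegral X → (∀ x : X, IsIntegrallyClosed (X.presheaf.stalk x)) →
        Scheme.HasResolution X →
          ∃ (Y : Scheme.{0}) (π : Y ⟶ X), IsProper π ∧ IsBirational π ∧ Scheme.IsRegular Y ∧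
            Scheme.IsRegular (pullback (π ≫ f) (Spec.map (CommRingCat.ofHom (algebraMap k K)))) := by
  intro h
  -- ### the witness
  let k : Type := baseField p
  let K : Type := extField p
  let f₁ : Spec (.of K) ⟶ Spec (.of k) := Spec.map (CommRingCat.ofHom (algebraMap k K))
  have hIC : ∀ x : ↥(Spec (CommRingCat.of K)),
      IsIntegrallyClosed ((Spec (CommRingCat.of K)).presheaf.stalk x) :=
    fun x => Literature.AlgebraicGeometry.Motives.isIntegrallyClosed_stalk_Spec (.of K) x
  obtain ⟨Y, π, -, hbir, -, hreg⟩ :=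
    h k K RatFunc.X (AdjoinRoot.root (insepPoly p)) (ratFuncX_ne_pow p) (root_pow_eq p)
      (adjoin_root_extField_eq_top p) (Spec (.of K)) f₁ inferInstance
      (locallyOfFiniteType_Spec_extField p) inferInstance inferInstance hIC
      (hasResolution_Spec_extField p)
  -- ### `π` is an isomorphism (birational onto a point)
  haveI : Subsingleton ↥(Spec (CommRingCat.of K)) :=
    inferInstanceAs (Subsingleton (PrimeSpectrum K))
  haveI : Nonempty ↥(Spec (CommRingCat.of K)) :=
    ⟨(⟨⊥, Ideal.isPrime_bot⟩ : PrimeSpectrum K)⟩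
  haveI hπ : IsIso π := isIso_of_isBirational_of_subsingleton π hbir
  -- ### hence `Y ×ₖ K ≅ Spec K ×ₖ Spec K`, which is not regular
  let e : pullback (π ≫ f₁) f₁ ⟶ pullback f₁ f₁ :=
    pullback.map (π ≫ f₁) f₁ f₁ f₁ π (𝟙 _) (𝟙 _) (by simp) (by simp)
  haveI : IsIso e := pullback.map_isIso _ _ _ _ _ _ _ _ _
  exact not_isRegular_pullback_extField p (hreg.of_iso e)

end Summit.ResolutionOfSingularities.ResolutionOfSingularities.Theorems.DescentPerfectToAll.Negative

end
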